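import Summits.RiemannHypothesis.RiemannHypothesis.Theorems.PfPersistenceDefectiveTransport
import Summits.RiemannHypothesis.RiemannHypothesis.Theorems.PfPersistenceFloorRate
import HarnessLib

/-!
# Defective Grönwall transport, part 3 — the conclusion sharpened to the quasi-Riemann hypothesis
# `QuasiRiemannHypothesis (1/2 + δ/2)` via the even FLOOR-RATE DICTIONARY (pub-rhpf: transport-1 gen 4,
# leaf G1.22 'TRANSPORT', track T-D × cand-7 gen 7, leaf G1.05 'floors'; RH-free glue; def-free)

**mechanism/rigidity campaign; no RH claims.**  Companion text:
`run/shared/lean/pub/pub-rhpf/pub-rhpf-transport-1/TRANSPORT.md` §13.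

`PfPersistenceDefectiveTransport.floor_of_defectiveLeakageFrom` (transport-1) turns the defective leakage
clause from one seed `a₀ < (log 3)/2` into the floor `ε(a) ≥ -(C/δ) e^{δ a}` of the FULL ground energy, and
read it through the tree dictionary `GroundStatesConvergeToXi.abs_re_sub_half_le_of_weilGroundEnergy_ge_neg_exp`
as the strip `|Re ρ − 1/2| ≤ δ`.  `PfPersistenceFloorRate.abs_re_sub_half_le_of_even_floor` (cand-7) SHARPENS
the dictionary by the factor `2` for floors of the EVEN-sector energy (centred symmetric translates).  Since
`ε ≤ ε_ev` (`weilGroundEnergy_le_weilEvenGroundEnergy`), the two compose: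

* `even_floor_of_defectiveLeakageFrom` — the clause ⟹ `-(C/δ) e^{δ a} ≤ ε_ev(a)` for every `a > 0`;
* `strip_half_of_defectiveLeakageFrom` — the clause ⟹ every non-trivial zero has `|Re ρ − 1/2| ≤ δ/2`;
* `quasiRiemannHypothesis_of_defectiveLeakageFrom` — the clause ⟹ `QuasiRiemannHypothesis (1/2 + δ/2)`
  (no zero of `ζ` in `1/2 + δ/2 < Re s < 1`);
* `quasiRiemannHypothesis_of_speedLimitFrom` — the rate-free member (`K ≡ 0`: the bottom never drops
  faster than `C e^{δ x}` past the seed) ⟹ the same.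

So the graded sandwich of T-D reads, for every `δ > 0` and `C ≥ 0`:
RH ⟹ (defective leakage at rate `δ`, defect `C`) ⟹ quasi-RH with abscissa `1/2 + δ/2` — the first
implication is `PfPersistenceDefectiveTransportCalibration.defectiveLeakageFrom_of_riemannHypothesis`, the
second is this file.  CONDITIONAL statements; RH-free; no RH claim in either direction.
-/

noncomputable section

set_option linter.dupNamespace false  -- D-0017 nested layout: `RiemannHypothesis.RiemannHypothesis`

namespace Summit.RiemannHypothesis.RiemannHypothesis.Theorems.PfPersistenceDefectiveTransport

open Set
open _root_.Literature.NumberTheory.LFunctions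
open _root_.Summit.RiemannHypothesis.RiemannHypothesis.Theorems.PfPersistenceFloorRate
  (abs_re_sub_half_le_of_even_floor quasiRiemannHypothesis_of_even_floor)

/-- **Defective leakage ⟹ an exponential floor for the EVEN-sector energy.**  The full-energy floor of
`floor_of_defectiveLeakageFrom` passes to `ε_ev ≥ ε`. CONDITIONAL; RH-free; no RH claim. [folklore] -/
theorem even_floor_of_defectiveLeakageFrom {a₀ C δ : ℝ} (ha₀ : 0 < a₀) (ha₀' : a₀ < Real.log 3 / 2)
    (hC : 0 ≤ C) (hδ : 0 < δ)
    (h : ∀ A : ℝ, a₀ ≤ A → ∃ K : ℝ, 0 ≤ K ∧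
      ∀ x ∈ Ico a₀ A, ∀ η δ' : ℝ, 0 < η → 0 < δ' →
        ∃ h : ℝ, 0 < h ∧ h < δ' ∧
          weilGroundEnergy x - weilGroundEnergy (x + h) ≤
            h * (K * weilGroundEnergy x + C * Real.exp (δ * x) + η)) :
    ∀ a : ℝ, 0 < a → -(C / δ * Real.exp (δ * a)) ≤ weilEvenGroundEnergy a :=
  fun a ha ↦ (floor_of_defectiveLeakageFrom ha₀ ha₀' hC hδ h a ha).trans
    (weilGroundEnergy_le_weilEvenGroundEnergy a)

/-- **T-D, sharpened: defective leakage at rate `δ` ⟹ `|Re ρ − 1/2| ≤ δ/2`** for every non-trivial zero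
(the even floor-rate dictionary `PfPersistenceFloorRate.abs_re_sub_half_le_of_even_floor` in place of the
tree's width-`δ` dictionary). CONDITIONAL; RH-free; no RH claim. [folklore] -/
theorem strip_half_of_defectiveLeakageFrom {a₀ C δ : ℝ} (ha₀ : 0 < a₀) (ha₀' : a₀ < Real.log 3 / 2)
    (hC : 0 ≤ C) (hδ : 0 < δ)
    (h : ∀ A : ℝ, a₀ ≤ A → ∃ K : ℝ, 0 ≤ K ∧
      ∀ x ∈ Ico a₀ A, ∀ η δ' : ℝ, 0 < η → 0 < δ' →
        ∃ h : ℝ, 0 < h ∧ h < δ' ∧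
          weilGroundEnergy x - weilGroundEnergy (x + h) ≤
            h * (K * weilGroundEnergy x + C * Real.exp (δ * x) + η))
    {ρ : ℂ} (hρ : ρ ∈ ZetaZeros.riemannZetaNontrivialZeros) : |ρ.re - 1 / 2| ≤ δ / 2 :=
  abs_re_sub_half_le_of_even_floor hδ.le (even_floor_of_defectiveLeakageFrom ha₀ ha₀' hC hδ h) hρ

/-- **Defective leakage at rate `δ` ⟹ the quasi-Riemann hypothesis with abscissa `1/2 + δ/2`**
(`ζ` has no zeros in `1/2 + δ/2 < Re s < 1`). CONDITIONAL; RH-free; no RH claim. [folklore] -/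
theorem quasiRiemannHypothesis_of_defectiveLeakageFrom {a₀ C δ : ℝ} (ha₀ : 0 < a₀)
    (ha₀' : a₀ < Real.log 3 / 2) (hC : 0 ≤ C) (hδ : 0 < δ)
    (h : ∀ A : ℝ, a₀ ≤ A → ∃ K : ℝ, 0 ≤ K ∧
      ∀ x ∈ Ico a₀ A, ∀ η δ' : ℝ, 0 < η → 0 < δ' →
        ∃ h : ℝ, 0 < h ∧ h < δ' ∧
          weilGroundEnergy x - weilGroundEnergy (x + h) ≤
            h * (K * weilGroundEnergy x + C * Real.exp (δ * x) + η)) :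
    QuasiRiemannHypothesis (1 / 2 + δ / 2) :=
  quasiRiemannHypothesis_of_even_floor hδ.le (a₀ := a₀)
    fun a ha ↦ even_floor_of_defectiveLeakageFrom ha₀ ha₀' hC hδ h a (ha₀.trans_le ha)

/-- **Rate-free member, sharpened: an exponential SPEED LIMIT at rate `δ` past the seed ⟹ quasi-RH with
abscissa `1/2 + δ/2`.** CONDITIONAL; RH-free; no RH claim. [folklore] -/
theorem quasiRiemannHypothesis_of_speedLimitFrom {a₀ C δ : ℝ} (ha₀ : 0 < a₀)
    (ha₀' : a₀ < Real.log 3 / 2) (hC : 0 ≤ C) (hδ : 0 < δ)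
    (h : ∀ x : ℝ, a₀ ≤ x → ∀ η δ' : ℝ, 0 < η → 0 < δ' →
      ∃ h : ℝ, 0 < h ∧ h < δ' ∧
        weilGroundEnergy x - weilGroundEnergy (x + h) ≤ h * (C * Real.exp (δ * x) + η)) :
    QuasiRiemannHypothesis (1 / 2 + δ / 2) :=
  quasiRiemannHypothesis_of_defectiveLeakageFrom ha₀ ha₀' hC hδ
    fun A _ ↦ ⟨0, le_rfl, fun x hx η δ' hη hδ' ↦ by simpa using h x hx.1 η δ' hη hδ'⟩

/-- **Contrapositive, sharpened (the off-line zero is visible in the descent SPEED).**  A non-trivial zero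
`ρ₀` and a rate `δ < 2 |Re ρ₀ − 1/2|` are incompatible with ANY speed limit `C e^{δ x}` past the seed:
for every `C ≥ 0` some window `x ≥ a₀` and some scale `δ' > 0` have ALL short steps `0 < h < δ'` dropping
the bottom by more than `h (C e^{δ x} + η)` for some `η > 0`. CONDITIONAL on the zero; RH-free; no RH
claim. [folklore] -/
theorem speedLimit_fails_of_offline_zero {a₀ C δ : ℝ} (ha₀ : 0 < a₀) (ha₀' : a₀ < Real.log 3 / 2)
    (hC : 0 ≤ C) (hδ : 0 < δ) {ρ₀ : ℂ} (hρ₀ : ρ₀ ∈ ZetaZeros.riemannZetaNontrivialZeros)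
    (hoff : δ / 2 < |ρ₀.re - 1 / 2|) :
    ∃ x : ℝ, a₀ ≤ x ∧ ∃ η δ' : ℝ, 0 < η ∧ 0 < δ' ∧
      ∀ h : ℝ, 0 < h → h < δ' →
        h * (C * Real.exp (δ * x) + η) < weilGroundEnergy x - weilGroundEnergy (x + h) := by
  by_contra hcon
  push Not at hcon
  have hstrip := strip_half_of_defectiveLeakageFrom ha₀ ha₀' hC hδ
    (fun A _ ↦ ⟨0, le_rfl, fun x hx η δ' hη hδ' ↦ ?_⟩) hρ₀
  · exact absurd hstrip (not_le.mpr hoff)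
  · obtain ⟨h, hpos, hlt, hle⟩ := hcon x hx.1 η δ' hη hδ'
    exact ⟨h, hpos, hlt, by simpa using hle⟩

end Summit.RiemannHypothesis.RiemannHypothesis.Theorems.PfPersistenceDefectiveTransport
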